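import Literature.NumberTheory.ModularForms.LevelOneHeckeSturmGenerators
import Literature.NumberTheory.ModularForms.LevelOneHeckeCharpoly
import Mathlib.RingTheory.AdjoinRoot
import Mathlib.RingTheory.OrzechProperty
import HarnessLib

/-!
# The Hecke ring of `S₂₄(SL₂(ℤ))`: `𝕋_ℤ = ℤ·1 ⊕ ℤ·T(2) = ℤ[T(2)] ≅ ℤ[X]/(X² − 1080X − 20468736)`
# (Hecke's example `k = 24`; Zagier, 1-2-3 §4.1)

D. Zagier, *Elliptic modular forms and their applications*, in *The 1-2-3 of Modular Forms* (2008), §4.1 (held copy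
`book:bruinier2008-1-2-3-modular-forms-lectures-at`, p0054): for `k = 24`, `dim S_k = 2`,
`T₂(ΔE₄³) = 696 ΔE₄³ + 20736000 Δ²`, `T₂(Δ²) = ΔE₄³ + 384 Δ²`, so `T₂` has characteristic polynomial
`X² − 1080X − 20468736` (`trace 1080 = 696 + 384`, `det = 696·384 − 20736000 = −20468736`) and eigenvalues
`540 ± 12√144169`. With the level-one generation theorem (`LevelOneHeckeSturmGenerators`: `T(1), …, T(d)`,
`d = dim S_k`, is a `ℤ`-basis of `𝕋_ℤ` — Edixhoven Thm. 2.5.11 / Kilford Prop. 6.2) this pins down the full Hecke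
ring of weight `24`:

* `WeightTwentyFour.heckeTCuspₗ_two_sq` (`T(2)² = 1080 T(2) + 20468736` on `S₂₄`, Cayley–Hamilton for the Hecke
  polynomial of `LevelOneHeckeCharpoly`), `heckeT₂_sq` (the same identity in `𝕋_ℤ`),
* ★ **`WeightTwentyFour.exists_int_eq_add_smul_heckeT₂`** (`𝕋_ℤ = ℤ·1 + ℤ·T(2)`), `finrank_levelOneHeckeRing_twentyFour`
  (`rank_ℤ 𝕋_ℤ = 2`),
* ★ **`WeightTwentyFour.adjoinRootEquivHeckeRing : ℤ[X]/(X² − 1080X − 20468736) ≃+* 𝕋_ℤ`**, `X ↦ T(2)`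
  (surjective by the generation theorem; injective because both sides are free of rank `2` over `ℤ` —
  Orzech/Vasconcelos).

No named facts; definitions `heckeT₂` (the element `T(2) ∈ 𝕋_ℤ`), `heckePolyTwo` (the integer polynomial) and the
equivalence `adjoinRootEquivHeckeRing` (data).

## References

* [Zagier2008] D. Zagier, *Elliptic modular forms and their applications*, in The 1-2-3 of Modular Forms (2008), §4.1.
* [Edixhoven2011] B. Edixhoven, Ch. 2 of *Computational Aspects of Modular Forms and Galois Representations*,
  Ann. of Math. Stud. 176 (2011), Thm. 2.5.11.
* [Kilford2008] L. J. P. Kilford, *Modular Forms: A Classical and Computational Introduction* (2008), §4.2.3, Prop. 6.2.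
-/

noncomputable section

open scoped MatrixGroups ModularForm
open UpperHalfPlane hiding I
open Polynomial

namespace Literature.NumberTheory.ModularForms

namespace WeightTwentyFour

/-! ## §1 `T(2)² = 1080 T(2) + 20468736` -/

/-- **`T(2)² = 1080·T(2) + 20468736` on `S₂₄(SL₂(ℤ))`** (Cayley–Hamilton for `det(X − T(2) | S₂₄) =
X² − 1080X − 20468736`). [cite: Zagier2008, §4.1] -/
theorem heckeTCuspₗ_two_sq :
    (heckeTCuspₗ two_pos : Module.End ℂ (CuspForm 𝒮ℒ 24)) ^ 2 =
      (1080 : ℂ) • (heckeTCuspₗ two_pos : Module.End ℂ (CuspForm 𝒮ℒ 24)) + (20468736 : ℂ) • 1 := by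
  haveI := finiteDimensional_cuspForm_levelOne (24 : ℤ)
  have h := LinearMap.aeval_self_charpoly (heckeTCuspₗ two_pos : Module.End ℂ (CuspForm 𝒮ℒ 24))
  rw [charpoly_heckeTCuspₗ_two_twentyFour, map_sub, map_sub, map_mul, aeval_C, aeval_C, map_pow, aeval_X,
    sub_sub, sub_eq_zero] at h
  rw [h, Algebra.algebraMap_eq_smul_one, Algebra.algebraMap_eq_smul_one, smul_mul_assoc, one_mul]

/-- **The element `T(2) ∈ 𝕋_ℤ` of the Hecke ring of weight `24`.** [cite: Zagier2008, §4.1] -/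
def heckeT₂ : levelOneHeckeRing 24 :=
  ⟨heckeTCuspₗ two_pos, heckeTCuspₗ_mem_levelOneHeckeRing two_pos⟩

/-- Unfolding lemma for `heckeT₂`. [cite: Zagier2008, §4.1] -/
@[simp] theorem coe_heckeT₂ : (heckeT₂ : Module.End ℂ (CuspForm 𝒮ℒ 24)) = heckeTCuspₗ two_pos :=
  rfl

/-- **`T(2)² = 1080·T(2) + 20468736·1` in the Hecke ring `𝕋_ℤ` of weight `24`.** [cite: Zagier2008, §4.1] -/
theorem heckeT₂_sq : heckeT₂ ^ 2 = (1080 : ℤ) • heckeT₂ + (20468736 : ℤ) • (1 : levelOneHeckeRing 24) := by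
  apply Subtype.ext
  rw [Subalgebra.coe_pow, coe_heckeT₂, heckeTCuspₗ_two_sq, Subalgebra.coe_add, Subalgebra.coe_smul,
    Subalgebra.coe_smul, Subalgebra.coe_one, coe_heckeT₂, ← Int.cast_smul_eq_zsmul ℂ (1080 : ℤ),
    ← Int.cast_smul_eq_zsmul ℂ (20468736 : ℤ)]
  norm_num

/-! ## §2 `𝕋_ℤ = ℤ·1 ⊕ ℤ·T(2)` -/

/-- ★ **`𝕋_ℤ(S₂₄) = ℤ·1 + ℤ·T(2)`**: every element of the weight-`24` Hecke ring (in particular every `T(m)`) is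
`c₀ + c₁T(2)` with `c₀, c₁ ∈ ℤ` (`dim S₂₄ = 2` generators `T(1) = 1`, `T(2)` suffice). [cite: Edixhoven2011,
Thm. 2.5.11] [cite: Zagier2008, §4.1] -/
theorem exists_int_eq_add_smul_heckeT₂ (T : levelOneHeckeRing 24) :
    ∃ c₀ c₁ : ℤ, T = c₀ • (1 : levelOneHeckeRing 24) + c₁ • heckeT₂ := by
  obtain ⟨c, hc⟩ := exists_int_combination_of_mem_levelOneHeckeRing (k := 24) (B := 2)
    (by rw [finrank_cuspForm_twentyFour]) T.2
  refine ⟨c 0, c 1, Subtype.ext ?_⟩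
  rw [hc, Fin.sum_univ_two, Subalgebra.coe_add, Subalgebra.coe_smul, Subalgebra.coe_smul, Subalgebra.coe_one,
    coe_heckeT₂]
  congr 1
  · congr 1
    exact LinearMap.ext fun g => (heckeTCusp_congr _ one_pos rfl g).trans (heckeTCusp_one g)

/-- `rank_ℤ 𝕋_ℤ(S₂₄) = 2`. [cite: Zagier2008, §4.1] [cite: Edixhoven2011, Thm. 2.5.11] -/
theorem finrank_levelOneHeckeRing_twentyFour : Module.finrank ℤ (levelOneHeckeRing 24) = 2 := by
  rw [finrank_levelOneHeckeRing, finrank_cuspForm_twentyFour]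

/-! ## §3 `𝕋_ℤ ≅ ℤ[X]/(X² − 1080X − 20468736)` -/

/-- **The integer Hecke polynomial `X² − 1080X − 20468736 ∈ ℤ[X]` of `T(2)` on `S₂₄`.** [cite: Zagier2008, §4.1] -/
def heckePolyTwo : ℤ[X] :=
  X ^ 2 - C 1080 * X - C 20468736

/-- Unfolding lemma for `heckePolyTwo`. [cite: Zagier2008, §4.1] -/
theorem heckePolyTwo_def : heckePolyTwo = X ^ 2 - C 1080 * X - C 20468736 :=
  rfl

/-- `X² − 1080X − 20468736 = X² − (1080X + 20468736)`. [cite: Zagier2008, §4.1] -/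
theorem heckePolyTwo_eq : heckePolyTwo = X ^ 2 - (C 1080 * X + C 20468736) := by
  rw [heckePolyTwo, sub_sub]

/-- The lower-order part has degree `≤ 1 < 2`. [cite: Zagier2008, §4.1] -/
theorem degree_lowerPart_lt : (C (1080 : ℤ) * X + C 20468736).degree < ((2 : ℕ) : WithBot ℕ) :=
  lt_of_le_of_lt ((degree_add_le _ _).trans (max_le (degree_C_mul_X_le _) (degree_C_le.trans zero_le_one)))
    (by exact_mod_cast one_lt_two)

/-- `X² − 1080X − 20468736` is monic. [cite: Zagier2008, §4.1] -/
theorem monic_heckePolyTwo : heckePolyTwo.Monic := by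
  rw [heckePolyTwo_eq]
  exact (monic_X_pow 2).sub_of_left (by rw [degree_X_pow]; exact degree_lowerPart_lt)

/-- `deg (X² − 1080X − 20468736) = 2`. [cite: Zagier2008, §4.1] -/
theorem natDegree_heckePolyTwo : heckePolyTwo.natDegree = 2 := by
  have hlt : (C (1080 : ℤ) * X + C 20468736).natDegree < (X ^ 2 : ℤ[X]).natDegree := by
    rw [natDegree_X_pow]
    calc (C (1080 : ℤ) * X + C 20468736).natDegree ≤ 1 :=
          (natDegree_add_le _ _).trans (max_le ((natDegree_C_mul_le _ _).trans (by rw [natDegree_X]))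
            (by rw [natDegree_C]; exact Nat.zero_le _))
      _ < 2 := by norm_num
  rw [heckePolyTwo_eq, natDegree_sub_eq_left_of_natDegree_lt hlt, natDegree_X_pow]

/-- **`T(2)` is a root of `X² − 1080X − 20468736` in `𝕋_ℤ`.** [cite: Zagier2008, §4.1] -/
theorem aeval_heckeT₂_heckePolyTwo : aeval heckeT₂ heckePolyTwo = 0 := by
  rw [heckePolyTwo, map_sub, map_sub, map_mul, map_pow, aeval_X, aeval_C, aeval_C,
    Algebra.algebraMap_eq_smul_one, Algebra.algebraMap_eq_smul_one, smul_mul_assoc, one_mul, heckeT₂_sq]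
  abel

/-- Every multiple of the Hecke polynomial kills `T(2)`. [cite: Zagier2008, §4.1] -/
theorem aeval_heckeT₂_eq_zero_of_mem {g : ℤ[X]} (hg : g ∈ Ideal.span {heckePolyTwo}) : aeval heckeT₂ g = 0 := by
  obtain ⟨q, rfl⟩ := Ideal.mem_span_singleton.mp hg
  rw [map_mul, aeval_heckeT₂_heckePolyTwo, zero_mul]

/-- **The ring homomorphism `ℤ[X]/(X² − 1080X − 20468736) → 𝕋_ℤ`, `X ↦ T(2)`** (the Hecke ring sits in the
non-commutative `End(S₂₄)`, so we lift `aeval T(2)` through the quotient by hand). [cite: Zagier2008, §4.1] -/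
def adjoinRootToHeckeRing : AdjoinRoot heckePolyTwo →+* levelOneHeckeRing 24 :=
  Ideal.Quotient.lift (Ideal.span {heckePolyTwo}) (aeval heckeT₂ : ℤ[X] →ₐ[ℤ] levelOneHeckeRing 24).toRingHom
    fun _ hg => aeval_heckeT₂_eq_zero_of_mem hg

/-- `adjoinRootToHeckeRing [g] = g(T(2))`. [cite: Zagier2008, §4.1] -/
@[simp] theorem adjoinRootToHeckeRing_mk (g : ℤ[X]) :
    adjoinRootToHeckeRing (AdjoinRoot.mk heckePolyTwo g) = aeval heckeT₂ g :=
  rfl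

/-- `X ↦ T(2)`. [cite: Zagier2008, §4.1] -/
@[simp] theorem adjoinRootToHeckeRing_root : adjoinRootToHeckeRing (AdjoinRoot.root heckePolyTwo) = heckeT₂ := by
  rw [AdjoinRoot.root, adjoinRootToHeckeRing_mk, aeval_X]

/-- **`ℤ[X]/(X² − 1080X − 20468736) → 𝕋_ℤ` is surjective** (`𝕋_ℤ = ℤ·1 + ℤ·T(2)`). [cite: Edixhoven2011,
Thm. 2.5.11] [cite: Zagier2008, §4.1] -/
theorem adjoinRootToHeckeRing_surjective : Function.Surjective adjoinRootToHeckeRing := by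
  intro T
  obtain ⟨c₀, c₁, hT⟩ := exists_int_eq_add_smul_heckeT₂ T
  refine ⟨AdjoinRoot.mk heckePolyTwo (C c₀ + C c₁ * X), ?_⟩
  rw [adjoinRootToHeckeRing_mk, map_add, map_mul, aeval_C, aeval_C, aeval_X, hT,
    Algebra.algebraMap_eq_smul_one, Algebra.algebraMap_eq_smul_one, smul_mul_assoc, one_mul]

/-- **`ℤ[X]/(X² − 1080X − 20468736) → 𝕋_ℤ` is injective**: both sides are free `ℤ`-modules of rank `2` and the
map is surjective (Orzech property of `ℤ`: a surjection onto a finite module from a module embedding into it is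
injective). [cite: Edixhoven2011, Thm. 2.5.11] [cite: Zagier2008, §4.1] -/
theorem adjoinRootToHeckeRing_injective : Function.Injective adjoinRootToHeckeRing := by
  haveI := finite_levelOneHeckeRing (24 : ℤ)
  -- a `ℤ`-linear isomorphism between the two rank-`2` lattices
  let pb := AdjoinRoot.powerBasis' monic_heckePolyTwo
  have hdim : pb.dim = Module.finrank ℂ (CuspForm 𝒮ℒ 24) := by
    change heckePolyTwo.natDegree = _
    rw [natDegree_heckePolyTwo, finrank_cuspForm_twentyFour]
  let e : AdjoinRoot heckePolyTwo ≃ₗ[ℤ] levelOneHeckeRing 24 :=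
    pb.basis.equiv (levelOneHeckeRing.basisT 24) (finCongr hdim)
  exact OrzechProperty.injective_of_surjective_of_injective e.toLinearMap
    adjoinRootToHeckeRing.toIntAlgHom.toLinearMap e.injective adjoinRootToHeckeRing_surjective

/-- ★ **`ℤ[X]/(X² − 1080X − 20468736) ≅ 𝕋_ℤ(S₂₄(SL₂(ℤ)))`, `X ↦ T(2)`**: the Hecke ring of weight `24` is the
quadratic order `ℤ[T(2)]` cut out by the Hecke polynomial of `T(2)` (an order in `ℚ(√144169)`).
[cite: Zagier2008, §4.1] [cite: Edixhoven2011, Thm. 2.5.11] [cite: Kilford2008, §4.2.3] -/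
def adjoinRootEquivHeckeRing : AdjoinRoot heckePolyTwo ≃+* levelOneHeckeRing 24 :=
  RingEquiv.ofBijective adjoinRootToHeckeRing ⟨adjoinRootToHeckeRing_injective, adjoinRootToHeckeRing_surjective⟩

/-- `adjoinRootEquivHeckeRing` sends the class of `X` to `T(2)`. [cite: Zagier2008, §4.1] -/
@[simp] theorem adjoinRootEquivHeckeRing_root :
    adjoinRootEquivHeckeRing (AdjoinRoot.root heckePolyTwo) = heckeT₂ :=
  adjoinRootToHeckeRing_root

/-- The underlying map of `adjoinRootEquivHeckeRing`. [cite: Zagier2008, §4.1] -/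
theorem adjoinRootEquivHeckeRing_apply (x : AdjoinRoot heckePolyTwo) :
    adjoinRootEquivHeckeRing x = adjoinRootToHeckeRing x :=
  rfl

/-- **`𝕋_ℤ(S₂₄) = ℤ[T(2)]`** as a `ℤ`-algebra. [cite: Zagier2008, §4.1] [cite: Edixhoven2011, Thm. 2.5.11] -/
theorem adjoin_heckeT₂_eq_top : Algebra.adjoin ℤ {heckeT₂} = ⊤ := by
  refine eq_top_iff.mpr fun T _ => ?_
  obtain ⟨c₀, c₁, rfl⟩ := exists_int_eq_add_smul_heckeT₂ T
  exact add_mem (Subalgebra.smul_mem _ (one_mem _) _)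
    (Subalgebra.smul_mem _ (Algebra.subset_adjoin (Set.mem_singleton _)) _)

end WeightTwentyFour

end Literature.NumberTheory.ModularForms
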